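import Summits.QuantumFields.BalabanUV.T4Continuum.Spine.NE9.DirectPairingApex
import Mathlib.Probability.Moments.SubGaussian

/-!
# T⁴ programme, spine estimate NE9 — THE RATE AT THE APEX: what the Wilson-loop EXPECTATIONS inherit from the King route's generating-function
# rate (node U0 made effective) — census item C45 of cell `pub-balaban-gaps`, seat ne9 (gen 14)

Cell `pub-balaban-gaps` (YM blitz G2, seat ne9, unit `pub-balaban-gaps-ne9-g14`; record `run/shared/lean/pub/pub-balaban-gaps/ne/NE9.md` §5 row C45).
Summits-side bookkeeping; elementary real analysis on hypothesis SHAPES plus one junction with the tree's apex vocabulary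
(`Missing.TorusScheme.expectAt`, `T4GenFunBounds.schemeZ` ∕ `prodObs` ∕ `gibbsMeasure`, `T4CauchySum.genFun`) and Mathlib's Hoeffding lemma.  NO definition.

WHY (the question gen 13 left in words: «an effective APEX would need new statement shapes»).  Gens 6–13 re-wired NE9's slot of the spine on
King's direct-pairing currency and made it EFFECTIVE up to one datum (C44): after `K` steps the block observable's GENERATING FUNCTION satisfies
`∣genFun Z (K+n) t − genFun Z K t∣ ≤ 2·vol·Δ_K` on `∣t∣ ≤ l₀`, uniformly in `n` (`DirectPairingCauchy.abs_genFun_add_sub_le`), with `Δ_K` explicit in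
the printed scalars and the E-side envelope (`DirectPairingCrossoverEffective` ∕ `…Envelope` ∕ `…EffectiveU6` ∕ `…EndEffective`).  But the programme's
TARGET is not the generating function: `Missing.HasContinuumLimit S` is the convergence of the joint EXPECTATIONS `S.expectAt K os = ⟨∏_{o∈os} W_o⟩_K`,
the DERIVATIVE of `genFun (schemeZ S os) K` at `t = 0` (`T4GenFunBounds.hasDerivAt_genFun_schemeZ_zero`), and the tree's node U0
(`T4Assembly.tendsto_expectAt_of_cauchySeq_genFun` ← `T4VitaliStep`, Vitali's theorem on a disc) is QUALITATIVE — a sup-norm rate for a sequence of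
functions says nothing about their derivatives by itself.  What carries a rate through the apex is CONVEXITY WITH CURVATURE CONTROL: every
`genFun (schemeZ S os) K` is the cumulant generating function of an observable bounded by `1`, hence (Jensen) `t·⟨F⟩_K ≤ genFun K t` and (Hoeffding)
`genFun K t − t·⟨F⟩_K ≤ t²∕2` for every real `t`.  This file types what that sandwich buys, two-sidedly:
* §1 (MODEL, one pair ∕ a sequence, the convex currency) `abs_sub_le_of_sandwich`: two functions each sandwiched `t·e ≤ f t ≤ t·e + c·t²∕2` on
  `0 < t ≤ l₀` and `ρ`-close at one `h ∈ ]0, l₀]` have `∣e − e'∣ ≤ ρ∕h + c·h∕2`; `le_sqrt_of_forall_window`: the whole window gives `∣e − e'∣ ≤ √(2cρ)` as soon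
  as `2ρ ≤ c·l₀²`; `expect_rate_of_sandwich`: along a sequence with King-type closeness `∣f (K+n) t − f K t∣ ≤ ρ_K → 0` the slopes `e K` are Cauchy WITH THE
  PAIR BOUND, converge to some `E`, and `∣e K − E∣ ≤ ρ_K∕h + c·h∕2` (every `h`), `≤ √(2c·ρ_K)` (once `2ρ_K ≤ c·l₀²`): the SQUARE ROOT of the function rate.
* §2 (MODEL, two-sided) `sandwich_sqrt_loss_sharp`: the square root is ATTAINED in this currency — for every `s > 0` an explicit pair (`t²∕4` with slope
  `0`; `t²∕4 + s² − max(s − t∕2, 0)²` with slope `s`), both sandwiched with `c = 1` on ALL `t > 0`, `s²`-close everywhere, slopes `s = √ρ` apart while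
  §1 gives `√(2ρ)`: sharp up to the factor `√2`, and no choice of window `l₀` helps.
* §3 (MODEL, the symmetric currency) `abs_sub_le_of_symmetric`: a third-order SYMMETRIC bound `∣f h − f (−h) − 2h·e∣ ≤ 2M·h³` (odd-order cancellation;
  for a cumulant generating function `M` is a third-cumulant bound of the tilted laws — free for bounded observables, NOT typed here) improves the pair
  bound to `ρ∕h + 2M·h²`, i.e. `6M·h₀²  = (3∕2)(4M)^{1∕3}ρ^{2∕3}` at `h₀³ = ρ∕(4M)` (`abs_sub_le_of_symmetric_opt`); `expect_rate_of_symmetric`: the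
  sequence form.  (Central differences of order `k` give `ρ^{1−1∕k}` from bounds on ALL Taylor coefficients — prose, not typed.)
* §4 (SCHEME level, BY NAME) `genFun_schemeZ_sandwich`: for every `TorusScheme` with `β_K ≥ 0` and measurable observables bounded by `1`, every string
  `os`, step `K` and real `t`: `t·S.expectAt K os ≤ genFun (schemeZ S os) K t ≤ t·S.expectAt K os + t²∕2` — Jensen (`ConvexOn.map_integral_le`) and
  Mathlib's Hoeffding lemma on `prodObs S K os` under `gibbsMeasure (S.P K) (S.β K)`, through the tree's dictionary `genFun_schemeZ_eq_cgf` ∕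
  `expectAt_eq_integral_gibbs`.
* §5 (SCHEME level END) `expectAt_rate_of_king`: King's per-string socket — EXACTLY the datum of `DirectPairingApex.stringwiseGenFunCauchy_of_king` for
  one string (`l₀ > 0`, `vol`, offset `K₀`, remainders `Δ_K → 0`, `∣log Z_{K₀+K+n}(t) − log Z_{K₀+K}(t) − c∣ ≤ vol·Δ_K` on `∣t∣ ≤ l₀`) — gives, BY NAME down
  to `S.expectAt`: `∣⟨∏W⟩_{K₀+K+n} − ⟨∏W⟩_{K₀+K}∣ ≤ 2·vol·Δ_K∕h + h∕2` for all `n` and `h ∈ ]0, l₀]`; a limit `E` of `K ↦ S.expectAt K os` with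
  `∣⟨∏W⟩_{K₀+K} − E∣ ≤ 2·vol·Δ_K∕h + h∕2`, hence `≤ 2·√(vol·Δ_K)` as soon as `4·vol·Δ_K ≤ l₀²`.

VERDICT FOR THE ROW (census C45).  The King route is effective AT THE APEX, not only at node U6: the continuum-limit error of the Wilson-loop EXPECTATION
after `K₀ + K` steps is at most `2√(vol·Δ_K)` with `Δ_K` the explicit generating-function remainder of C44 — so C44's rate table passes to the
expectations with every exponent HALVED (geometric ratio `r` per step ⇒ `√r`; polynomial `(K+1)^{−pβ∕(β+4)}` ⇒ `(K+1)^{−pβ∕(2(β+4))}`; `K(ε)` ⇒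
`K(ε²∕(4·vol))`), and in the convex currency — the only structure the tree's node U0 inputs carry besides analyticity — the halving is SHARP up to `√2`
(§2); a third-order symmetric bound recovers the exponent `2∕3` (§3).  Printed precedent: none for d = 4; King's (3.13) p. 657 stops at «{Z^{ε_K}} is a
Cauchy sequence».  NOTHING new is owed by the E-side (the sandwich is a property of every bounded observable); CLASSIFICATION OF NE9 UNCHANGED: WORK-bound
(W1 = the one-step renormalization transformation as a Lean object; instance 0∕1).

HONEST FRAMING: bookkeeping for rung (B)+1 on ONE FIXED finite four-torus; §§1–3 are MODEL-level real analysis on hypothesis SHAPES (label MODEL), §§4–5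
are junctions with the tree's apex vocabulary under King's matching SHAPE — the cell's located estimate, NOT in print for Bałaban's d = 4 procedure; every
bound is a MODEL-level formula, not a certified constant of Bałaban's; NE9 NOT PRINTED ∕ NOT PROVED; spine PROVED 0∕9 unchanged; instance 0∕1; NOT UV
stability, NOT the continuum limit, NOT infinite volume, NOT a mass gap, NOT Clay.  DEPENDENCY: continuum YM on T⁴ ⇐ BetaPertH ∧ nine spine estimates (0∕9).

References (TYPES only): [King1986] = C. King, Commun. Math. Phys. **102** (1986) 649–677, Thm 3.4 (3.9) p. 656, (3.13) p. 657; Hoeffding's lemma = W. Hoeffding,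
J. Amer. Statist. Assoc. **58** (1963) 13–30, used ONLY as Mathlib's proved `hasSubgaussianMGF_of_mem_Icc` (paper not held; no locator asserted); [JaffeWittenClay2006] §6.5 p. 11.
-/

namespace Summit.QuantumFields.BalabanUV.T4Continuum.NE9.DirectPairingApexEffective

open scoped BigOperators
open Filter Topology MeasureTheory ProbabilityTheory
open Literature.MathematicalPhysics.QuantumFieldTheory.Balaban1983to89
open T4CauchySum (genFun)
open Missing (TorusScheme)
open Summit.QuantumFields.BalabanUV.T4Continuum.NE9.DirectPairingCauchy (abs_genFun_add_sub_le)

/-! ## §1 The convex (Jensen–Hoeffding) currency -/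

section Convex

/-- **ONE PAIR.**  Two functions sandwiched at one point `h > 0` — `h·e ≤ f h ≤ h·e + c·h²∕2` and `h·e' ≤ f' h ≤ h·e' + c·h²∕2` (the shape of
Jensen + Hoeffding for a cumulant generating function with slope `e` at `0`) — and `ρ`-close there have slopes `∣e − e'∣ ≤ ρ∕h + c·h∕2`.  MODEL-level.
[folklore] -/
theorem abs_sub_le_of_sandwich {f f' : ℝ → ℝ} {e e' c ρ h : ℝ} (hh : 0 < h)
    (hf : h * e ≤ f h) (hf' : f' h - h * e' ≤ c * h ^ 2 / 2)
    (hg : h * e' ≤ f' h) (hg' : f h - h * e ≤ c * h ^ 2 / 2)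
    (hd : |f h - f' h| ≤ ρ) : |e - e'| ≤ ρ / h + c * h / 2 := by
  obtain ⟨hd1, hd2⟩ := abs_le.mp hd
  have k1 : h * (e - e') ≤ ρ + c * h ^ 2 / 2 := by rw [mul_sub]; linarith
  have k2 : h * (e' - e) ≤ ρ + c * h ^ 2 / 2 := by rw [mul_sub]; linarith
  have e1 : ρ / h + c * h / 2 = (ρ + c * h ^ 2 / 2) / h := by
    field_simp
  rw [e1, abs_sub_le_iff, le_div_iff₀ hh, le_div_iff₀ hh]
  constructor <;> linarith

/-- A quantity below `φ h` for every `h` of a window `]0, l₀]`, `φ h → 0` as `h → 0⁺`, is `≤ 0`. [folklore] -/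
theorem nonpos_of_forall_window {x l₀ : ℝ} {φ : ℝ → ℝ} (hl₀ : 0 < l₀) (hφ : Tendsto φ (𝓝[>] 0) (𝓝 0))
    (hx : ∀ h, 0 < h → h ≤ l₀ → x ≤ φ h) : x ≤ 0 := by
  by_contra hx0'
  have hx0 : 0 < x := lt_of_not_ge hx0'
  have hev : ∀ᶠ h in 𝓝[>] (0 : ℝ), φ h < x ∧ h ∈ Set.Ioc (0 : ℝ) l₀ :=
    (hφ.eventually (gt_mem_nhds hx0)).and (Ioc_mem_nhdsGT hl₀)
  obtain ⟨h, h1, h2, h3⟩ := hev.exists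
  exact lt_irrefl x ((hx h h2 h3).trans_lt h1)

/-- `c·h∕2 → 0` as `h → 0⁺`. [folklore] -/
theorem tendsto_linear_window (c : ℝ) : Tendsto (fun h : ℝ => c * h / 2) (𝓝[>] 0) (𝓝 0) := by
  have h1 : Tendsto (fun h : ℝ => c * h / 2) (𝓝 0) (𝓝 (c * 0 / 2)) :=
    ((continuous_const.mul continuous_id).div_const 2).tendsto 0
  rw [mul_zero, zero_div] at h1
  exact tendsto_nhdsWithin_of_tendsto_nhds h1

/-- **THE SQUARE ROOT.**  If `x ≤ ρ∕h + c·h∕2` for EVERY `h ∈ ]0, l₀]` (`ρ ≥ 0`, `c > 0`) and the optimal point fits the window, `2ρ ≤ c·l₀²`, then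
`x ≤ √(2cρ)` (at `h = √(2ρ∕c)`; for `ρ = 0` by letting `h → 0⁺`).  MODEL-level. [folklore] -/
theorem le_sqrt_of_forall_window {x c ρ l₀ : ℝ} (hl₀ : 0 < l₀) (hc : 0 < c) (hρ : 0 ≤ ρ)
    (hx : ∀ h, 0 < h → h ≤ l₀ → x ≤ ρ / h + c * h / 2) (hwin : 2 * ρ ≤ c * l₀ ^ 2) :
    x ≤ Real.sqrt (2 * c * ρ) := by
  rcases hρ.eq_or_lt with hρ0 | hρpos
  · -- `ρ = 0`: the window bound is `c·h∕2 → 0`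
    rw [← hρ0, mul_zero, Real.sqrt_zero]
    refine nonpos_of_forall_window hl₀ (tendsto_linear_window c) fun h hh hhl => ?_
    simpa [← hρ0] using hx h hh hhl
  · set s := Real.sqrt (2 * c * ρ) with hs_def
    have hspos : 0 < s := Real.sqrt_pos.mpr (by positivity)
    have hs2 : s ^ 2 = 2 * c * ρ := Real.sq_sqrt (by positivity)
    have hhpos : 0 < s / c := div_pos hspos hc
    have hsl : s ≤ l₀ * c := by
      have h2 : 2 * c * ρ ≤ (l₀ * c) ^ 2 := by nlinarith [mul_le_mul_of_nonneg_left hwin hc.le]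
      calc s = Real.sqrt (2 * c * ρ) := rfl
        _ ≤ Real.sqrt ((l₀ * c) ^ 2) := Real.sqrt_le_sqrt h2
        _ = l₀ * c := Real.sqrt_sq (by positivity)
    have hhl : s / c ≤ l₀ := by rwa [div_le_iff₀ hc]
    have key := hx (s / c) hhpos hhl
    have e1 : ρ / (s / c) + c * (s / c) / 2 = s := by
      have hcs : c * ρ = s ^ 2 / 2 := by rw [hs2]; ring
      field_simp
      nlinarith [hcs]
    rwa [e1] at key

variable {f : ℕ → ℝ → ℝ} {e ρ : ℕ → ℝ} {c l₀ : ℝ}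

/-- **THE PAIR BOUND ALONG A SEQUENCE.**  Functions `f K` sandwiched `t·e K ≤ f K t ≤ t·e K + c·t²∕2` on `0 < t ≤ l₀` and King-close there,
`∣f (K+n) t − f K t∣ ≤ ρ_K`, have slopes `∣e (K+n) − e K∣ ≤ ρ_K∕h + c·h∕2` for every `n` and `h ∈ ]0, l₀]`.  MODEL-level. [folklore] -/
theorem pair_bound_of_sandwich
    (hsw : ∀ K t, 0 < t → t ≤ l₀ → t * e K ≤ f K t ∧ f K t - t * e K ≤ c * t ^ 2 / 2)
    (hclose : ∀ K n t, 0 < t → t ≤ l₀ → |f (K + n) t - f K t| ≤ ρ K)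
    (K n : ℕ) {h : ℝ} (hh : 0 < h) (hhl : h ≤ l₀) :
    |e (K + n) - e K| ≤ ρ K / h + c * h / 2 :=
  abs_sub_le_of_sandwich hh (hsw (K + n) h hh hhl).1 (hsw K h hh hhl).2 (hsw K h hh hhl).1 (hsw (K + n) h hh hhl).2
    (hclose K n h hh hhl)

/-- **CAUCHY FROM A PAIR BOUND** `∣e (K+n) − e K∣ ≤ ρ_K∕h + φ h` (all `n`, `h ∈ ]0, l₀]`) with `ρ_K → 0` and `φ h → 0` as `h → 0⁺`. [folklore] -/
theorem cauchySeq_of_pairBound {φ : ℝ → ℝ} (hl₀ : 0 < l₀) (hφ : Tendsto φ (𝓝[>] 0) (𝓝 0))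
    (hb : ∀ K n h, 0 < h → h ≤ l₀ → |e (K + n) - e K| ≤ ρ K / h + φ h)
    (hρ : Tendsto ρ atTop (𝓝 0)) : CauchySeq e := by
  refine Metric.cauchySeq_iff'.2 fun ε hε => ?_
  have hev : ∀ᶠ h in 𝓝[>] (0 : ℝ), φ h < ε / 2 ∧ h ∈ Set.Ioc (0 : ℝ) l₀ :=
    (hφ.eventually (gt_mem_nhds (half_pos hε))).and (Ioc_mem_nhdsGT hl₀)
  obtain ⟨h, hφh, hh, hhl⟩ := hev.exists
  have hρ' : ∀ᶠ K in atTop, ρ K < ε / 2 * h := hρ.eventually (gt_mem_nhds (by positivity))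
  obtain ⟨N, hN⟩ := eventually_atTop.1 hρ'
  refine ⟨N, fun n hn => ?_⟩
  obtain ⟨k, rfl⟩ := Nat.exists_eq_add_of_le hn
  rw [Real.dist_eq]
  have h1 := hb N k h hh hhl
  have h2 : ρ N / h < ε / 2 := by
    rw [div_lt_iff₀ hh]
    exact hN N le_rfl
  linarith

/-- **THE LIMIT INHERITS THE PAIR BOUND**: `e → E` and `∣e (K+n) − e K∣ ≤ ρ_K∕h + φ h` for all `n` give `∣e K − E∣ ≤ ρ_K∕h + φ h`. [folklore] -/
theorem limit_le_of_pairBound {E : ℝ} {φ : ℝ → ℝ}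
    (hb : ∀ K n h, 0 < h → h ≤ l₀ → |e (K + n) - e K| ≤ ρ K / h + φ h)
    (hE : Tendsto e atTop (𝓝 E)) (K : ℕ) {h : ℝ} (hh : 0 < h) (hhl : h ≤ l₀) :
    |e K - E| ≤ ρ K / h + φ h := by
  have hE' : Tendsto (fun n => e (K + n)) atTop (𝓝 E) :=
    ((tendsto_add_atTop_iff_nat K).2 hE).congr fun n => by rw [add_comm]
  have hc : Tendsto (fun n => |e (K + n) - e K|) atTop (𝓝 |E - e K|) := (hE'.sub_const _).abs
  have hle := le_of_tendsto' hc fun n => hb K n h hh hhl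
  rwa [abs_sub_comm] at hle

/-- **THE SLOPES CONVERGE AT THE SQUARE ROOT OF THE FUNCTION RATE.**  Functions `f K` sandwiched `t·e K ≤ f K t ≤ t·e K + c·t²∕2` on `0 < t ≤ l₀`
(`l₀ > 0`, `c > 0`) and King-close, `∣f (K+n) t − f K t∣ ≤ ρ_K` there for all `n` with `ρ_K → 0`: the slopes `e K` converge to some `E` with
`∣e K − E∣ ≤ ρ_K∕h + c·h∕2` for every `h ∈ ]0, l₀]`, hence `∣e K − E∣ ≤ √(2c·ρ_K)` as soon as `2ρ_K ≤ c·l₀²`.  MODEL-level. [folklore] -/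
theorem expect_rate_of_sandwich (hl₀ : 0 < l₀) (hc : 0 < c)
    (hsw : ∀ K t, 0 < t → t ≤ l₀ → t * e K ≤ f K t ∧ f K t - t * e K ≤ c * t ^ 2 / 2)
    (hclose : ∀ K n t, 0 < t → t ≤ l₀ → |f (K + n) t - f K t| ≤ ρ K)
    (hρ : Tendsto ρ atTop (𝓝 0)) :
    ∃ E : ℝ, Tendsto e atTop (𝓝 E) ∧
      (∀ K h, 0 < h → h ≤ l₀ → |e K - E| ≤ ρ K / h + c * h / 2) ∧
      (∀ K, 2 * ρ K ≤ c * l₀ ^ 2 → |e K - E| ≤ Real.sqrt (2 * c * ρ K)) := by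
  have hb : ∀ K n h, 0 < h → h ≤ l₀ → |e (K + n) - e K| ≤ ρ K / h + c * h / 2 :=
    fun K n h hh hhl => pair_bound_of_sandwich hsw hclose K n hh hhl
  obtain ⟨E, hE⟩ := cauchySeq_tendsto_of_complete (cauchySeq_of_pairBound hl₀ (tendsto_linear_window c) hb hρ)
  refine ⟨E, hE, fun K h hh hhl => limit_le_of_pairBound hb hE K hh hhl, fun K hK => ?_⟩
  have hρ0 : 0 ≤ ρ K := (abs_nonneg _).trans (hclose K 0 l₀ hl₀ le_rfl)
  exact le_sqrt_of_forall_window hl₀ hc hρ0 (fun h hh hhl => limit_le_of_pairBound hb hE K hh hhl) hK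

end Convex

/-! ## §2 The square root is attained in the convex currency -/

section Sharp

/-- **THE SQUARE-ROOT LOSS IS SHARP IN THE CONVEX CURRENCY (up to `√2`).**  For every `s > 0` the pair `f t = t²∕4` (slope `e = 0`) and
`f' t = t²∕4 + s² − max(s − t∕2, 0)²` (slope `e' = s`; `f' t = s·t` for `t ≤ 2s`) is sandwiched with `c = 1` on ALL `t > 0` — no window `l₀` helps —,
is `s²`-close everywhere, and has slopes exactly `s = √(s²)` apart, while §1 bounds the gap by `√(2·1·s²) = √2·s`.  MODEL-level witness (not claimed to
be a pair of cumulant generating functions). [folklore] -/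
theorem sandwich_sqrt_loss_sharp {s : ℝ} (hs : 0 < s) :
    ∃ f f' : ℝ → ℝ, ∃ e e' : ℝ,
      (∀ t, 0 < t → t * e ≤ f t ∧ f t - t * e ≤ 1 * t ^ 2 / 2) ∧
      (∀ t, 0 < t → t * e' ≤ f' t ∧ f' t - t * e' ≤ 1 * t ^ 2 / 2) ∧
      (∀ t, 0 < t → |f t - f' t| ≤ s ^ 2) ∧ |e - e'| = s ∧ Real.sqrt (2 * 1 * s ^ 2) = Real.sqrt 2 * s := by
  refine ⟨fun t => t ^ 2 / 4, fun t => t ^ 2 / 4 + s ^ 2 - (max (s - t / 2) 0) ^ 2, 0, s, ?_, ?_, ?_, ?_, ?_⟩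
  · intro t ht
    constructor <;> nlinarith
  · intro t ht
    dsimp only
    rcases le_total (s - t / 2) 0 with h | h
    · rw [max_eq_right h]
      constructor <;> nlinarith
    · rw [max_eq_left h]
      constructor <;> nlinarith
  · intro t ht
    dsimp only
    rw [abs_le]
    rcases le_total (s - t / 2) 0 with h | h
    · rw [max_eq_right h]
      constructor <;> nlinarith
    · rw [max_eq_left h]
      constructor <;> nlinarith
  · rw [zero_sub, abs_neg, abs_of_pos hs]
  · rw [mul_one, Real.sqrt_mul' _ (sq_nonneg s), Real.sqrt_sq hs.le]

end Sharp

/-! ## §3 The symmetric (third-order) currency -/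

section Symmetric

/-- **ONE PAIR, SYMMETRIC.**  Two functions with the third-order symmetric bounds `∣f h − f (−h) − 2h·e∣ ≤ 2M·h³`, `∣f' h − f' (−h) − 2h·e'∣ ≤ 2M·h³`
(odd-order cancellation of the central difference) and `ρ`-close at `±h` have slopes `∣e − e'∣ ≤ ρ∕h + 2M·h²`.  MODEL-level. [folklore] -/
theorem abs_sub_le_of_symmetric {f f' : ℝ → ℝ} {e e' M ρ h : ℝ} (hh : 0 < h)
    (hf : |f h - f (-h) - 2 * h * e| ≤ 2 * M * h ^ 3) (hf' : |f' h - f' (-h) - 2 * h * e'| ≤ 2 * M * h ^ 3)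
    (hd : |f h - f' h| ≤ ρ) (hd' : |f (-h) - f' (-h)| ≤ ρ) : |e - e'| ≤ ρ / h + 2 * M * h ^ 2 := by
  obtain ⟨a1, a2⟩ := abs_le.mp hf
  obtain ⟨b1, b2⟩ := abs_le.mp hf'
  obtain ⟨c1, c2⟩ := abs_le.mp hd
  obtain ⟨d1, d2⟩ := abs_le.mp hd'
  have k1 : 2 * h * (e - e') ≤ 2 * ρ + 4 * M * h ^ 3 := by rw [mul_sub]; linarith
  have k2 : 2 * h * (e' - e) ≤ 2 * ρ + 4 * M * h ^ 3 := by rw [mul_sub]; linarith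
  have e1 : ρ / h + 2 * M * h ^ 2 = (2 * ρ + 4 * M * h ^ 3) / (2 * h) := by
    field_simp
    ring
  have h2 : 0 < 2 * h := by positivity
  rw [e1, abs_sub_le_iff, le_div_iff₀ h2, le_div_iff₀ h2]
  constructor <;> linarith

/-- … at the optimal point `h₀ = (ρ∕(4M))^{1∕3}` (`ρ ≥ 0`, `M > 0`): `ρ∕h₀ + 2M·h₀² = 6M·h₀² = (3∕2)·(4M)^{1∕3}·ρ^{2∕3}` — the exponent `2∕3`. [folklore] -/
theorem abs_sub_le_of_symmetric_opt {f f' : ℝ → ℝ} {e e' M ρ : ℝ} (hM : 0 < M) (hρ : 0 < ρ)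
    (hf : ∀ h, 0 < h → |f h - f (-h) - 2 * h * e| ≤ 2 * M * h ^ 3)
    (hf' : ∀ h, 0 < h → |f' h - f' (-h) - 2 * h * e'| ≤ 2 * M * h ^ 3)
    (hd : ∀ t, |f t - f' t| ≤ ρ) :
    |e - e'| ≤ 6 * M * ((ρ / (4 * M)) ^ ((3 : ℕ) : ℝ)⁻¹) ^ 2 := by
  set h₀ : ℝ := (ρ / (4 * M)) ^ ((3 : ℕ) : ℝ)⁻¹ with hh₀
  have hq : 0 < ρ / (4 * M) := by positivity
  have hh₀pos : 0 < h₀ := Real.rpow_pos_of_pos hq _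
  have hcube : h₀ ^ 3 = ρ / (4 * M) := Real.rpow_inv_natCast_pow hq.le (by norm_num)
  have key := abs_sub_le_of_symmetric hh₀pos (hf h₀ hh₀pos) (hf' h₀ hh₀pos) (hd h₀) (hd (-h₀))
  have e1 : ρ / h₀ = 4 * M * h₀ ^ 2 := by
    rw [div_eq_iff hh₀pos.ne']
    have : ρ = 4 * M * h₀ ^ 3 := by rw [hcube]; field_simp
    rw [this]
    ring
  rw [e1] at key
  linarith

variable {f : ℕ → ℝ → ℝ} {e ρ : ℕ → ℝ} {M l₀ : ℝ}

/-- **THE SLOPES CONVERGE AT THE EXPONENT `2∕3` IN THE SYMMETRIC CURRENCY.**  Functions `f K` with `∣f K h − f K (−h) − 2h·e K∣ ≤ 2M·h³` on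
`0 < h ≤ l₀` and King-close on `0 < ∣t∣ ≤ l₀`, `∣f (K+n) t − f K t∣ ≤ ρ_K → 0`: the slopes converge to some `E` with `∣e K − E∣ ≤ ρ_K∕h + 2M·h²` for
every `h ∈ ]0, l₀]`.  MODEL-level. [folklore] -/
theorem expect_rate_of_symmetric (hl₀ : 0 < l₀)
    (hsym : ∀ K h, 0 < h → h ≤ l₀ → |f K h - f K (-h) - 2 * h * e K| ≤ 2 * M * h ^ 3)
    (hclose : ∀ K n t, 0 < |t| → |t| ≤ l₀ → |f (K + n) t - f K t| ≤ ρ K)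
    (hρ : Tendsto ρ atTop (𝓝 0)) :
    ∃ E : ℝ, Tendsto e atTop (𝓝 E) ∧ ∀ K h, 0 < h → h ≤ l₀ → |e K - E| ≤ ρ K / h + 2 * M * h ^ 2 := by
  have hb : ∀ K n h, 0 < h → h ≤ l₀ → |e (K + n) - e K| ≤ ρ K / h + 2 * M * h ^ 2 := by
    intro K n h hh hhl
    have hpos : 0 < |h| := abs_pos.mpr hh.ne'
    have hle : |h| ≤ l₀ := by rwa [abs_of_pos hh]
    have hpos' : 0 < |(-h)| := by rwa [abs_neg]
    have hle' : |(-h)| ≤ l₀ := by rwa [abs_neg]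
    exact abs_sub_le_of_symmetric hh (hsym (K + n) h hh hhl) (hsym K h hh hhl) (hclose K n h hpos hle)
      (hclose K n (-h) hpos' hle')
  have hφ : Tendsto (fun h : ℝ => 2 * M * h ^ 2) (𝓝[>] 0) (𝓝 0) := by
    have h1 : Tendsto (fun h : ℝ => 2 * M * h ^ 2) (𝓝 0) (𝓝 (2 * M * 0 ^ 2)) :=
      (continuous_const.mul (continuous_pow 2)).tendsto 0
    rw [zero_pow two_ne_zero, mul_zero] at h1
    exact tendsto_nhdsWithin_of_tendsto_nhds h1
  obtain ⟨E, hE⟩ := cauchySeq_tendsto_of_complete (cauchySeq_of_pairBound hl₀ hφ hb hρ)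
  exact ⟨E, hE, fun K h hh hhl => limit_le_of_pairBound hb hE K hh hhl⟩

end Symmetric

/-! ## §4 Scheme level: the Jensen–Hoeffding sandwich of node U6's generating functions, BY NAME -/

section Scheme

variable {G : Type*} [GaugeGroup G] [MeasurableSpace G] [RegularGaugeGroup G] [HaarData G] {O : Type*}

/-- **THE SANDWICH FOR EVERY STRING OF A TORUS SCHEME.**  For a scheme with `β_K ≥ 0` and measurable observables bounded by `1`, every string `os`,
step `K` and real `t`: `t·S.expectAt K os ≤ genFun (schemeZ S os) K t` (Jensen) and `genFun (schemeZ S os) K t − t·S.expectAt K os ≤ t²∕2`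
(Hoeffding's lemma for the product observable `prodObs S K os ∈ [−1, 1]` under `gibbsMeasure (S.P K) (S.β K)`), through the tree's dictionary
`T4GenFunBounds.genFun_schemeZ_eq_cgf` ∕ `expectAt_eq_integral_gibbs` (Hoeffding's lemma enters as Mathlib's PROVED `hasSubgaussianMGF_of_mem_Icc`). [folklore] -/
theorem genFun_schemeZ_sandwich (S : TorusScheme G O) (hβ : ∀ K, 0 ≤ S.β K)
    (hm : ∀ K o, Measurable (S.obs K o)) (h1 : ∀ K o U, |S.obs K o U| ≤ 1) (K : ℕ) (os : List O) (t : ℝ) :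
    t * S.expectAt K os ≤ genFun (T4GenFunBounds.schemeZ S os) K t ∧
      genFun (T4GenFunBounds.schemeZ S os) K t - t * S.expectAt K os ≤ t ^ 2 / 2 := by
  haveI : IsProbabilityMeasure (T4GenFunBounds.gibbsMeasure (G := G) (S.P K) (S.β K)) :=
    T4GenFunBounds.isProbabilityMeasure_gibbsMeasure (S.P K) (hβ K)
  set μ := T4GenFunBounds.gibbsMeasure (G := G) (S.P K) (S.β K) with hμ
  set X := T4GenFunBounds.prodObs S K os with hX
  have hXm : AEMeasurable X μ := (T4GenFunBounds.measurable_prodObs S hm K os).aemeasurable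
  have hXb : ∀ U, |X U| ≤ 1 := T4GenFunBounds.abs_prodObs_le_one S h1 K os
  have hXIcc : ∀ᵐ U ∂μ, X U ∈ Set.Icc (-1 : ℝ) 1 := Eventually.of_forall fun U => abs_le.mp (hXb U)
  have hXi : Integrable X μ := Integrable.of_mem_Icc (-1) 1 hXm hXIcc
  have hint : ∀ u : ℝ, Integrable (fun U => Real.exp (u * X U)) μ := fun u => integrable_exp_mul_of_mem_Icc hXm hXIcc
  rw [T4GenFunBounds.genFun_schemeZ_eq_cgf S hβ hm h1 K os t, T4GenFunBounds.expectAt_eq_integral_gibbs S hβ K os]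
  constructor
  · -- Jensen: `exp (t·E X) ≤ E exp (tX)`
    have hJ : Real.exp (∫ U, t * X U ∂μ) ≤ ∫ U, Real.exp (t * X U) ∂μ :=
      ConvexOn.map_integral_le (f := fun U => t * X U) convexOn_exp Real.continuous_exp.continuousOn isClosed_univ
        (Eventually.of_forall fun _ => Set.mem_univ _) (hXi.const_mul t) (hint t)
    rw [integral_const_mul] at hJ
    exact (Real.le_log_iff_exp_le (mgf_pos (hint t))).mpr hJ
  · -- Hoeffding: `cgf (X − E X) t ≤ t²∕2`, and `cgf (X − m) t = cgf X t − t·m`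
    have hH := (hasSubgaussianMGF_of_mem_Icc (a := -1) (b := 1) hXm hXIcc).cgf_le t
    have hc1 : (((‖(1 : ℝ) - (-1 : ℝ)‖₊ / 2) ^ 2 : NNReal) : ℝ) = 1 := by
      rw [NNReal.coe_pow, NNReal.coe_div, coe_nnnorm, Real.norm_eq_abs]
      norm_num
    rw [hc1] at hH
    have hshift : cgf (fun U => X U - ∫ V, X V ∂μ) μ t = cgf X μ t - t * ∫ V, X V ∂μ := by
      have hfun : (fun U => X U - ∫ V, X V ∂μ) = fun U => X U + (-(∫ V, X V ∂μ)) := by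
        funext U
        ring
      rw [cgf, hfun, mgf_add_const, Real.log_mul (mgf_pos (hint t)).ne' (Real.exp_pos _).ne', Real.log_exp]
      simp only [cgf]
      ring
    rw [hshift] at hH
    linarith

/-! ## §5 King's per-string socket ⇒ an explicit rate for the Wilson-loop expectations -/

/-- **THE RATE AT THE APEX.**  For a scheme with `β_K ≥ 0` and measurable observables bounded by `1`, and ONE string `os` carrying King's socket —
`l₀ > 0`, a volume factor `vol`, an offset `K₀` and remainders `Δ_K → 0` with `∣log Z_{K₀+K+n}(t) − log Z_{K₀+K}(t) − c∣ ≤ vol·Δ_K` on `∣t∣ ≤ l₀` for all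
`K`, `n` (`Z = schemeZ S os`; EXACTLY the per-string datum of `DirectPairingApex.stringwiseGenFunCauchy_of_king`) — the joint EXPECTATIONS satisfy, for
all `K`, `n` and `h ∈ ]0, l₀]`, `∣S.expectAt (K₀+K+n) os − S.expectAt (K₀+K) os∣ ≤ 2·vol·Δ_K∕h + h∕2`; they converge to some `E` with
`∣S.expectAt (K₀+K) os − E∣ ≤ 2·vol·Δ_K∕h + h∕2` for every `h ∈ ]0, l₀]`, hence `≤ 2·√(vol·Δ_K)` as soon as `4·vol·Δ_K ≤ l₀²` — the SQUARE ROOT of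
node U6's rate (`DirectPairingCauchy.abs_genFun_add_sub_le` + §4 + §1).  CONDITIONAL kernel theorem on a hypothesis SHAPE (King's matching).
[cite: King1986, Thm 3.4 (3.9) p. 656, p. 657] [folklore] -/
theorem expectAt_rate_of_king (S : TorusScheme G O) (hβ : ∀ K, 0 ≤ S.β K)
    (hm : ∀ K o, Measurable (S.obs K o)) (h1 : ∀ K o U, |S.obs K o U| ≤ 1) (os : List O)
    {l₀ vol : ℝ} {K₀ : ℕ} {Δ : ℕ → ℝ} (hl₀ : 0 < l₀) (hΔ : Tendsto Δ atTop (𝓝 0))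
    (hU5 : ∀ K n : ℕ, ∃ c : ℝ, ∀ t : ℝ, |t| ≤ l₀ →
      |Real.log (T4GenFunBounds.schemeZ S os (K₀ + (K + n)) t) -
          Real.log (T4GenFunBounds.schemeZ S os (K₀ + K) t) - c| ≤ vol * Δ K) :
    (∀ K n h, 0 < h → h ≤ l₀ →
        |S.expectAt (K₀ + (K + n)) os - S.expectAt (K₀ + K) os| ≤ 2 * (vol * Δ K) / h + h / 2) ∧
      ∃ E : ℝ, Tendsto (fun K => S.expectAt K os) atTop (𝓝 E) ∧
        (∀ K h, 0 < h → h ≤ l₀ → |S.expectAt (K₀ + K) os - E| ≤ 2 * (vol * Δ K) / h + h / 2) ∧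
        (∀ K, 4 * (vol * Δ K) ≤ l₀ ^ 2 → |S.expectAt (K₀ + K) os - E| ≤ 2 * Real.sqrt (vol * Δ K)) := by
  -- the sandwich (§4) and King's closeness of the generating functions, re-indexed from the offset `K₀`
  have hsw : ∀ K t, 0 < t → t ≤ l₀ →
      t * S.expectAt (K₀ + K) os ≤ genFun (fun K => T4GenFunBounds.schemeZ S os (K₀ + K)) K t ∧
        genFun (fun K => T4GenFunBounds.schemeZ S os (K₀ + K)) K t - t * S.expectAt (K₀ + K) os ≤ 1 * t ^ 2 / 2 := by
    intro K t _ _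
    have h := genFun_schemeZ_sandwich S hβ hm h1 (K₀ + K) os t
    simpa only [genFun, one_mul] using h
  have hclose : ∀ K n t, 0 < t → t ≤ l₀ →
      |genFun (fun K => T4GenFunBounds.schemeZ S os (K₀ + K)) (K + n) t -
          genFun (fun K => T4GenFunBounds.schemeZ S os (K₀ + K)) K t| ≤ 2 * (vol * Δ K) := by
    intro K n t ht htl
    exact abs_genFun_add_sub_le (Z := fun K => T4GenFunBounds.schemeZ S os (K₀ + K)) hU5 hl₀.le K n
      ((abs_of_pos ht).le.trans htl)
  have hρ : Tendsto (fun K => 2 * (vol * Δ K)) atTop (𝓝 0) := by simpa using (hΔ.const_mul vol).const_mul 2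
  have hpair : ∀ K n h, 0 < h → h ≤ l₀ →
      |S.expectAt (K₀ + (K + n)) os - S.expectAt (K₀ + K) os| ≤ 2 * (vol * Δ K) / h + h / 2 := by
    intro K n h hh hhl
    have := pair_bound_of_sandwich (e := fun K => S.expectAt (K₀ + K) os) hsw hclose K n hh hhl
    simpa only [add_assoc, one_mul] using this
  refine ⟨hpair, ?_⟩
  obtain ⟨E, hE, hEb, hEs⟩ := expect_rate_of_sandwich (e := fun K => S.expectAt (K₀ + K) os) hl₀ one_pos hsw hclose hρ
  refine ⟨E, ?_, fun K h hh hhl => by simpa only [one_mul] using hEb K h hh hhl, fun K hK => ?_⟩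
  · -- remove the offset
    have hE' : Tendsto (fun K => S.expectAt (K + K₀) os) atTop (𝓝 E) := hE.congr fun K => by rw [add_comm]
    exact (tendsto_add_atTop_iff_nat K₀).1 hE'
  · have h2 : 2 * (2 * (vol * Δ K)) ≤ 1 * l₀ ^ 2 := by linarith
    have h3 := hEs K h2
    have e1 : Real.sqrt (2 * 1 * (2 * (vol * Δ K))) = 2 * Real.sqrt (vol * Δ K) := by
      rw [show (2 : ℝ) * 1 * (2 * (vol * Δ K)) = 2 ^ 2 * (vol * Δ K) by ring, Real.sqrt_mul (by positivity),
        Real.sqrt_sq (by norm_num)]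
    rwa [e1] at h3

end Scheme

end Summit.QuantumFields.BalabanUV.T4Continuum.NE9.DirectPairingApexEffective
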